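import Summits.QuantumFields.Balaban3D.Proofs.AxialGaugeFix
import Summits.QuantumFields.Balaban3D.Proofs.Translation13

/-!
# `Summit.QuantumFields.Balaban3D.Proofs.AxialGaugeShift` — [Balaban1985UV3] (13) p. 259 «We make a change of variables in the integral over Ω₁
# taking U = U′U₁» FOR THE LANE'S AVERAGING at `Ω₁ = T`: with a BACKGROUND field `U₁` in the radial axial gauge and in the fibre of `V`
# (print (12): «U : Ū = V on Ω₁^{(1)}, U satisfies axial gauge conditions on Ω₁»), the gauge-fixed fibre integral of `…Proofs.AxialGauge` becomes
# `(Tρ)(V) = ∫ ρ(U′_W · U₁) dW`, where the FLUCTUATION FIELD `U′_W = fluct W` is `1` on the forest AND on the crossing bonds and free elsewhere —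
# print's «∫dU′↾_{Ω₁} δ((U′U₁)‾(Ū₁)^{−1}) δ_{Ax(Ω₁)}(U′) … exp[−A(U′U₁)/g₀² − E]» with both δ's resolved (seat p4, lane `pub-balaban3d`; step F3 of
# HOME/drafts/p4/FIBRE49.md on top of F4 = `AxialGauge`)

HONEST FRAMING (lane PLAN.md §0, binding): see `…Proofs.SectAFirstStep`.  [folklore] (Haar right invariance on the free bonds); nothing of the paper is
asserted.  The background `U₁` is a PARAMETER here (print: [7] Thm 1's minimizer, binder b11; the lane: `X.UkH 1 h′ V`); its two printed properties
are the hypotheses `hax` (axial gauge on the forest) and `hfib` (`Ū₁ = V`, i.e. `U₁(crossing bond of c) = V(c)` in that gauge).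
-/

noncomputable section

namespace Summit.QuantumFields.Balaban3D.Proofs.AxialGaugeShift

open _root_.MeasureTheory
open Literature.MathematicalPhysics.QuantumFieldTheory.Balaban1983to89
open Literature.MathematicalPhysics.QuantumFieldTheory.Balaban1983to89.AveragingRT (axialAvg rnTransport)
open Literature.MathematicalPhysics.QuantumFieldTheory.Balaban1983to89.GaugeField (GaugeInvariant)
open Summit.QuantumFields.Balaban3D.Carriers
open Summit.QuantumFields.Balaban3D.Proofs.AxialGauge
open Summit.QuantumFields.Balaban3D.Proofs.AxialGaugeFix

variable {P : Params} {j : ℕ} {G : Type*} [GaugeGroup G] [MeasurableSpace G] [HaarData G] [MeasurableMul₂ G] [MeasurableInv G]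
  [DecidableEq (PBond P j)]

/-- THE FLUCTUATION FIELD of print's (13): `1` on the radial forest and on the crossing bonds, the free Haar variable elsewhere —
`fluct W := axGlue 1 W`. [cite: Balaban1985UV3, (13) p.259] -/
def fluct (W : GaugeField P j G) : GaugeField P j G := axGlue (1 : GaugeField P (j + 1) G) W

omit [MeasurableSpace G] [HaarData G] [MeasurableMul₂ G] [MeasurableInv G] [DecidableEq (PBond P j)] in
/-- In the radial axial gauge a field in the fibre of `V` carries `V(c)` on the crossing bond of the line of `c`: `Ū₁ = V` ⟺ `U₁ ∘ crossBond = V`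
given `U₁ = 1` on the forest. [folklore] -/
theorem apply_crossBond_eq_of_axial (hj : j + 1 ≤ P.m + P.K) (U₁ : GaugeField P j G) (hax : ∀ b ∈ forest P j, U₁ b = 1)
    (c : PBond P (j + 1)) : U₁ (crossBond c) = axialAvg U₁ c := by
  rw [axialAvg_eq_head_mul_cross_mul_tail]
  have hh : ∀ n, n ≤ mid P → AveragingRT.pathProd U₁ c n = 1 := by
    intro n hn
    induction n with
    | zero => rfl
    | succ n ih =>
      have hL := P.hL.2
      show AveragingRT.pathProd U₁ c n * U₁ (AveragingRT.line c n) = 1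
      rw [ih (by omega), hax _ (line_mem_radialBonds hj c (by unfold mid at hn; omega) (by omega))]; exact one_mul 1
  have ht : ∀ n, n ≤ mid P → tailProd U₁ c n = 1 := by
    intro n hn
    induction n with
    | zero => rfl
    | succ n ih =>
      have hL : mid P + 1 + mid P = P.L := by unfold mid; obtain ⟨k, hk⟩ := P.hL.1; omega
      show tailProd U₁ c n * U₁ (AveragingRT.line c (mid P + 1 + n)) = 1
      rw [ih (by omega), hax _ (line_mem_radialBonds hj c (by omega) (by omega))]; exact one_mul 1
  rw [hh _ le_rfl, ht _ le_rfl]; group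

omit [MeasurableSpace G] [HaarData G] [MeasurableMul₂ G] [MeasurableInv G] in
/-- **`U = U′U₁` on the gauge-fixed fibre**: for a background `U₁` that is `1` on the forest (axial gauge) and has `Ū₁ = V`, translating the free
variables by `U₁` turns the fibre configuration over `V` into the bondwise product `fluct W · U₁`. [cite: Balaban1985UV3, (12)–(13) p.258–259] -/
theorem axGlue_mulRight (hj : j + 1 ≤ P.m + P.K) (V : GaugeField P (j + 1) G) (U₁ : GaugeField P j G)
    (hax : ∀ b ∈ forest P j, U₁ b = 1) (hfib : axialAvg U₁ = V) (W : GaugeField P j G) :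
    axGlue V (fun b => W b * U₁ b) = fun b => fluct W b * U₁ b := by
  funext b
  unfold fluct
  by_cases hT : b ∈ forest P j
  · rw [axGlue_of_mem_forest hj, axGlue_of_mem_forest hj _ _ hT, hax b hT, mul_one]
    exact hT
  · by_cases hX : ∃ c, crossBond c = b
    · obtain ⟨c, rfl⟩ := hX
      rw [axGlue_cross hj, axGlue_cross hj, apply_crossBond_eq_of_axial hj U₁ hax c, hfib]
      exact (one_mul _).symm
    · have hX' : ∀ c, b ≠ crossBond c := fun c h => hX ⟨c, h.symm⟩
      rw [axGlue_free _ _ hT hX', axGlue_free _ _ hT hX']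

omit [MeasurableInv G] in
/-- **(13) FOR THE LANE**: the gauge-fixed fibre integral over `V` equals the integral over the fluctuation field translated by the background,
`∫ F(axGlue V W) dW = ∫ F(fluct W · U₁) dW` (Haar right invariance on every bond, `Translation13.integral_comp_mulRight`). [cite: Balaban1985UV3, (13) p.259] -/
theorem integral_axGlue_eq_integral_fluct_mul (hj : j + 1 ≤ P.m + P.K) (V : GaugeField P (j + 1) G) (U₁ : GaugeField P j G)
    (hax : ∀ b ∈ forest P j, U₁ b = 1) (hfib : axialAvg U₁ = V) (F : GaugeField P j G → ℝ) :
    ∫ W, F (axGlue V W) ∂(fieldMeasure P j G) = ∫ W, F (fun b => fluct W b * U₁ b) ∂(fieldMeasure P j G) := by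
  rw [← Translation13.integral_comp_mulRight U₁ (fun W => F (axGlue V W))]
  refine integral_congr_ae (Filter.Eventually.of_forall fun W => ?_)
  simp only [axGlue_mulRight hj V U₁ hax hfib W]

/-- **THE TRANSFORM AS A FLUCTUATION INTEGRAL AROUND A BACKGROUND** ((10) + (13) for the decimation average, Ω₁ = T): for a measurable, integrable,
gauge-invariant `ρ` and a background field `U₁(V)` per coarse field — `1` on the radial forest, `Ū₁(V) = V` — `(Tρ)(V) = ∫ ρ(fluct W · U₁(V)) dW`
for dV-a.e. `V`.  (Print takes `U₁(V)` = the constrained minimizer of [7]; here it is any such selection.) [cite: Balaban1985UV3, (13) p.259] -/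
theorem rnTransport_ae_eq_integral_fluct (hj : j + 1 ≤ P.m + P.K) (ρ : Density P j G) (hρi : Integrable ρ (fieldMeasure P j G))
    (hρm : Measurable ρ) (hρinv : GaugeInvariant ρ) (U₁ : GaugeField P (j + 1) G → GaugeField P j G)
    (hax : ∀ V, ∀ b ∈ forest P j, U₁ V b = 1) (hfib : ∀ V, axialAvg (U₁ V) = V) :
    rnTransport (axialAvg : GaugeField P j G → GaugeField P (j + 1) G) ρ
      =ᵐ[fieldMeasure P (j + 1) G] fun V => ∫ W, ρ (fun b => fluct W b * U₁ V b) ∂(fieldMeasure P j G) :=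
  (rnTransport_axialGauge_ae_eq hj ρ hρi hρm hρinv).trans
    (Filter.Eventually.of_forall fun V => integral_axGlue_eq_integral_fluct_mul hj V (U₁ V) (hax V) (hfib V) ρ)

end Summit.QuantumFields.Balaban3D.Proofs.AxialGaugeShift

end
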